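import Summits.QuantumAdvantage.QuantumAdvantage.Theorems.SymplecticPurityCubeGraphFlat
import Mathlib.Analysis.CStarAlgebra.Matrix

/-!
# Crux `DeqThesis` (stmt-QuantumAdvantage-0242), line `Sketch` — stub `stub_lightFlat`

`CubeLocallyFlat` in the LIGHT regime: the normalised cube graph state
`ĝ = (√2ⁿ)⁻¹ · Σ_x |x⟩|e((e⁻¹x)³)⟩` on `n + n` qubits is `2^{-n/4}`-flat (for `n ≥ 8`) against every
locally rotated Pauli string `O = ⊗ᵢ Mᵢ`, `Mᵢ = uᵢ σ_{Sᵢ} uᵢ†` (`S ≠ I`), whenever the Bloch `ℓ¹`-mass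
`∏_{i ∈ supp S} Σ_{P ∈ {X,Y,Z}} |½ Tr(σ_P Mᵢ)|` is at most `√2ⁿ`.

Proof.
* `tensorAll_eq_sum_pauliString` — the Pauli expansion of a product operator,
  `⊗ᵢ Aᵢ = Σ_R (∏ᵢ ½ Tr(σ_{Rᵢ} Aᵢ)) σ_R` (one-qubit expansion `Pauli.eq_half_sum_trace_smul` and
  multilinearity, `Finset.prod_univ_sum`), hence `⟨v| ⊗ᵢ Aᵢ |v⟩ = Σ_R c_R ⟨v| σ_R |v⟩`.
* `norm_dot_tensorAll_mulVec_le` — bookkeeping for a layer `Mᵢ` of one-qubit unitaries with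
  `Mᵢ = 1` off `supp S` and `Tr Mᵢ = 0` on it: the only flip-free word with a non-zero coefficient is
  `R_Z = Z^{supp S}`, with `|c_{R_Z}| ≤ 1` (entries of a unitary have modulus `≤ 1`); every other word
  flips a bit, and `Σ_R |c_R| = ∏_{i ∈ supp S} Σ_{P ∈ {X,Y,Z}} |½ Tr(σ_P Mᵢ)|`. So
  `|⟨v|O|v⟩| ≤ B₁ + B₂ · (Bloch mass)` given `|⟨v|σ_{R_Z}|v⟩| ≤ B₁` and `|⟨v|σ_R|v⟩| ≤ B₂` for
  flipping `R`.
* For the unnormalised cube graph vector `g`, `B₁ = 2 √2ⁿ` (`cubeGraphFlat_main`: near-bentness of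
  `x³`) and `B₂ = 2` (`card_cube_graph_pairs_le_two`: almost perfect nonlinearity), so in the light
  regime `|⟨g|O|g⟩| ≤ 4 √2ⁿ`, i.e. `|⟨ĝ|O|ĝ⟩| ≤ 4 / √2ⁿ ≤ 2^{-n/4}` for `n ≥ 8`.
-/

set_option linter.dupNamespace false

namespace Summit.QuantumAdvantage.QuantumAdvantage.Theorems.SymplecticPurity

open Matrix Finset Literature.Computability.QuantumComplexity Literature.Computability.Cryptography

/-! ### Pauli expansion of a product operator -/

/-- **Pauli expansion of a product operator**: `⊗ᵢ Aᵢ = Σ_R (∏ᵢ ½ Tr(σ_{Rᵢ} Aᵢ)) · σ_R`, the sum over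
all Pauli words `R` (one-qubit expansion on every wire, expanded by multilinearity). -/
theorem tensorAll_eq_sum_pauliString {ι : Type*} [Fintype ι] [DecidableEq ι]
    (A : ι → Matrix Bool Bool ℂ) :
    tensorAll A = ∑ R : ι → Pauli, (∏ i, ((R i).mat * A i).trace / 2) • pauliString R := by
  ext x y
  have h1 : ∀ i, A i (x i) (y i) = ∑ Q : Pauli, (Q.mat * A i).trace / 2 * Q.mat (x i) (y i) := by
    intro i
    have h := congrFun (congrFun (Pauli.eq_half_sum_trace_smul (A i)) (x i)) (y i)
    rw [h]
    simp only [Matrix.smul_apply, Matrix.sum_apply, smul_eq_mul, Finset.mul_sum]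
    refine Finset.sum_congr rfl fun Q _ => ?_
    ring
  rw [tensorAll_apply, Matrix.sum_apply]
  simp_rw [h1]
  rw [Finset.prod_univ_sum, Fintype.piFinset_univ]
  refine Finset.sum_congr rfl fun R _ => ?_
  rw [Matrix.smul_apply, smul_eq_mul, Finset.prod_mul_distrib, pauliString_eq, tensorAll_apply]

/-- Expectation of a product operator as the coefficient-weighted sum of Pauli-string expectations:
`⟨v| ⊗ᵢ Aᵢ |v⟩ = Σ_R (∏ᵢ ½ Tr(σ_{Rᵢ} Aᵢ)) ⟨v| σ_R |v⟩`. -/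
theorem star_dot_tensorAll_mulVec {ι : Type*} [Fintype ι] [DecidableEq ι]
    (A : ι → Matrix Bool Bool ℂ) (v : (ι → Bool) → ℂ) :
    star v ⬝ᵥ (tensorAll A *ᵥ v) =
      ∑ R : ι → Pauli, (∏ i, ((R i).mat * A i).trace / 2) * (star v ⬝ᵥ (pauliString R *ᵥ v)) := by
  rw [tensorAll_eq_sum_pauliString, Matrix.sum_mulVec, dotProduct_sum]
  refine Finset.sum_congr rfl fun R _ => ?_
  rw [Matrix.smul_mulVec, dotProduct_smul, smul_eq_mul]

/-! ### One-qubit facts -/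

/-- The Pauli matrices are unitary. -/
theorem pauliMat_mem_unitaryGroup (Q : Pauli) : Q.mat ∈ Matrix.unitaryGroup Bool ℂ := by
  rw [Matrix.mem_unitaryGroup_iff, Matrix.star_eq_conjTranspose, Pauli.conjTranspose_mat,
    Pauli.mat_mul_self]

/-- Traces of the Pauli matrices: `Tr σ_Q = 2 [Q = I]`. -/
theorem trace_pauliMat (Q : Pauli) : Q.mat.trace = if Q = Pauli.I then 2 else 0 := by
  have h := Pauli.trace_mat_mul_mat Pauli.I Q
  rw [show Pauli.I.mat = (1 : Matrix Bool Bool ℂ) from rfl, Matrix.one_mul] at h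
  rw [h]
  by_cases hQ : Q = Pauli.I
  · rw [if_pos hQ, if_pos hQ.symm]
  · rw [if_neg hQ, if_neg (Ne.symm hQ)]

/-- `|Tr(σ_Q U)| ≤ 2` for a one-qubit unitary `U`: row `a` of `σ_Q` has a single unimodular entry,
and the entries of `U` have modulus at most `1`. -/
theorem norm_trace_pauliMat_mul_le {U : Matrix Bool Bool ℂ} (hU : U ∈ Matrix.unitaryGroup Bool ℂ)
    (Q : Pauli) : ‖(Q.mat * U).trace‖ ≤ 2 := by
  have hdiag : ∀ a, (Q.mat * U) a a = Pauli.rowPhase Q a * U (Bool.xor a Q.flipsBit) a := by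
    intro a
    rw [Matrix.mul_apply]
    simpa only [smul_eq_mul] using Pauli.sum_mat_smul Q a (fun b => U b a)
  have h1 : ∀ a, ‖(Q.mat * U) a a‖ ≤ 1 := by
    intro a
    rw [hdiag, norm_mul, norm_rowPhase, one_mul]
    exact entry_norm_bound_of_unitary hU _ _
  rw [Matrix.trace, Fintype.sum_bool, Matrix.diag_apply, Matrix.diag_apply]
  refine (norm_add_le _ _).trans ?_
  linarith [h1 true, h1 false]

/-- The one-site coefficients `½ Tr(σ_Q U)` of a one-qubit unitary have modulus at most `1`. -/
theorem norm_half_trace_le_one {U : Matrix Bool Bool ℂ} (hU : U ∈ Matrix.unitaryGroup Bool ℂ)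
    (Q : Pauli) : ‖(Q.mat * U).trace / 2‖ ≤ 1 := by
  rw [norm_div, Complex.norm_two, div_le_one (by norm_num : (0 : ℝ) < 2)]
  exact norm_trace_pauliMat_mul_le hU Q

/-! ### Bookkeeping of the expansion of a rotated Pauli string -/

/-- **The light-regime bookkeeping.** Let `Mᵢ` be one-qubit unitaries with `Mᵢ = 1` where `Sᵢ = I`
and `Tr Mᵢ = 0` where `Sᵢ ≠ I`. If `|⟨v| σ_{R_Z} |v⟩| ≤ B₁` for the word `R_Z = Z^{supp S}` and
`|⟨v| σ_R |v⟩| ≤ B₂` for every word flipping a bit, then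
`|⟨v| ⊗ᵢ Mᵢ |v⟩| ≤ B₁ + B₂ · ∏_{i ∈ supp S} Σ_{P ∈ {X,Y,Z}} |½ Tr(σ_P Mᵢ)|`: in the Pauli expansion
of `⊗ᵢ Mᵢ` the only flip-free word with a non-zero coefficient is `R_Z` (coefficient of modulus `≤ 1`),
and the total coefficient mass is the product of the one-site Bloch masses. -/
theorem norm_dot_tensorAll_mulVec_le {ι : Type*} [Fintype ι] [DecidableEq ι]
    (M : ι → Matrix Bool Bool ℂ) (hMu : ∀ i, M i ∈ Matrix.unitaryGroup Bool ℂ) (S : ι → Pauli)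
    (hI : ∀ i, S i = Pauli.I → M i = 1) (htr : ∀ i, S i ≠ Pauli.I → (M i).trace = 0)
    (v : (ι → Bool) → ℂ) {B₁ B₂ : ℝ} (hB₂ : 0 ≤ B₂)
    (hZ : ‖star v ⬝ᵥ (pauliString (fun i => if S i = Pauli.I then Pauli.I else Pauli.Z) *ᵥ v)‖ ≤ B₁)
    (hX : ∀ R : ι → Pauli, (∃ k, (R k).flipsBit = true) → ‖star v ⬝ᵥ (pauliString R *ᵥ v)‖ ≤ B₂) :
    ‖star v ⬝ᵥ (tensorAll M *ᵥ v)‖ ≤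
      B₁ + B₂ * ∏ i ∈ Finset.univ.filter (fun i => S i ≠ Pauli.I),
        (∑ P ∈ ({Pauli.X, Pauli.Y, Pauli.Z} : Finset Pauli), ‖(P.mat * M i).trace‖ / 2) := by
  classical
  -- one-site coefficient facts
  have ha_le : ∀ i (Q : Pauli), ‖(Q.mat * M i).trace / 2‖ ≤ 1 := fun i Q => norm_half_trace_le_one (hMu i) Q
  have haI : ∀ i, S i = Pauli.I → ∀ Q : Pauli,
      (Q.mat * M i).trace / 2 = if Q = Pauli.I then 1 else 0 := by
    intro i hi Q
    rw [hI i hi, Matrix.mul_one, trace_pauliMat]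
    split_ifs <;> norm_num
  have haS : ∀ i, S i ≠ Pauli.I → (Pauli.I.mat * M i).trace / 2 = 0 := by
    intro i hi
    rw [show Pauli.I.mat = (1 : Matrix Bool Bool ℂ) from rfl, Matrix.one_mul, htr i hi, zero_div]
  -- the distinguished flip-free word
  set RZ : ι → Pauli := fun i => if S i = Pauli.I then Pauli.I else Pauli.Z with hRZ
  -- pointwise bound on the terms of the expansion
  have hpt : ∀ R : ι → Pauli,
      ‖(∏ i, ((R i).mat * M i).trace / 2) * (star v ⬝ᵥ (pauliString R *ᵥ v))‖ ≤
        B₂ * ∏ i, ‖((R i).mat * M i).trace / 2‖ + if R = RZ then B₁ else 0 := by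
    intro R
    rw [norm_mul, norm_prod]
    have hnn : 0 ≤ ∏ i, ‖((R i).mat * M i).trace / 2‖ :=
      Finset.prod_nonneg fun i _ => norm_nonneg _
    by_cases hfl : ∃ k, (R k).flipsBit = true
    · have hne : R ≠ RZ := by
        rintro rfl
        obtain ⟨k, hk⟩ := hfl
        simp only [hRZ] at hk
        split_ifs at hk <;> simp [Pauli.flipsBit] at hk
      rw [if_neg hne, add_zero]
      calc (∏ i, ‖((R i).mat * M i).trace / 2‖) * ‖star v ⬝ᵥ (pauliString R *ᵥ v)‖
          ≤ (∏ i, ‖((R i).mat * M i).trace / 2‖) * B₂ :=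
            mul_le_mul_of_nonneg_left (hX R hfl) hnn
        _ = B₂ * ∏ i, ‖((R i).mat * M i).trace / 2‖ := mul_comm _ _
    · push Not at hfl
      have hfl' : ∀ k, (R k).flipsBit = false := fun k => Bool.eq_false_iff.mpr (hfl k)
      by_cases hR : R = RZ
      · rw [if_pos hR]
        have hle1 : ∏ i, ‖((R i).mat * M i).trace / 2‖ ≤ 1 :=
          Finset.prod_le_one (fun i _ => norm_nonneg _) fun i _ => ha_le i (R i)
        have hd : ‖star v ⬝ᵥ (pauliString R *ᵥ v)‖ ≤ B₁ := by rw [hR]; exact hZ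
        calc (∏ i, ‖((R i).mat * M i).trace / 2‖) * ‖star v ⬝ᵥ (pauliString R *ᵥ v)‖
            ≤ 1 * B₁ := mul_le_mul hle1 hd (norm_nonneg _) zero_le_one
          _ ≤ B₂ * ∏ i, ‖((R i).mat * M i).trace / 2‖ + B₁ := by
            rw [one_mul]; exact le_add_of_nonneg_left (mul_nonneg hB₂ hnn)
      · -- some wire kills the coefficient
        obtain ⟨k, hk⟩ := Function.ne_iff.1 hR
        have h0 : ‖((R k).mat * M k).trace / 2‖ = 0 := by
          rw [norm_eq_zero]
          rcases eq_I_or_eq_Z_of_flipsBit (hfl' k) with h | h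
          · -- `R k = I`, so `RZ k = Z`, i.e. `S k ≠ I`
            have hSk : S k ≠ Pauli.I := by
              intro hS
              apply hk
              rw [h, hRZ]
              simp only [hS, if_true]
            rw [h]
            exact haS k hSk
          · -- `R k = Z`, so `RZ k = I`, i.e. `S k = I`
            have hSk : S k = Pauli.I := by
              by_contra hS
              apply hk
              rw [h, hRZ]
              simp only [hS, if_false]
            rw [h, haI k hSk]
            simp
        have h0' : ∏ i, ‖((R i).mat * M i).trace / 2‖ = 0 :=
          Finset.prod_eq_zero (Finset.mem_univ k) h0
        rw [h0', zero_mul, mul_zero, zero_add, if_neg hR]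
  -- per-site coefficient masses
  have hsite : ∀ i, ∑ Q : Pauli, ‖(Q.mat * M i).trace / 2‖ =
      if S i ≠ Pauli.I then
        ∑ P ∈ ({Pauli.X, Pauli.Y, Pauli.Z} : Finset Pauli), ‖(P.mat * M i).trace‖ / 2
      else 1 := by
    intro i
    split_ifs with h
    · rw [Pauli.sum_univ, haS i h, norm_zero, zero_add, Finset.sum_insert (by decide),
        Finset.sum_pair (by decide)]
      simp only [norm_div, Complex.norm_two]
      ring
    · push Not at h
      rw [Pauli.sum_univ, haI i h, haI i h, haI i h, haI i h]
      simp
  -- summing up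
  rw [star_dot_tensorAll_mulVec]
  calc ‖∑ R : ι → Pauli, (∏ i, ((R i).mat * M i).trace / 2) * (star v ⬝ᵥ (pauliString R *ᵥ v))‖
      ≤ ∑ R : ι → Pauli, ‖(∏ i, ((R i).mat * M i).trace / 2) * (star v ⬝ᵥ (pauliString R *ᵥ v))‖ :=
        norm_sum_le _ _
    _ ≤ ∑ R : ι → Pauli, (B₂ * ∏ i, ‖((R i).mat * M i).trace / 2‖ + if R = RZ then B₁ else 0) :=
        Finset.sum_le_sum fun R _ => hpt R
    _ = B₂ * (∑ R : ι → Pauli, ∏ i, ‖((R i).mat * M i).trace / 2‖) + B₁ := by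
        rw [Finset.sum_add_distrib, Finset.mul_sum, Fintype.sum_ite_eq']
    _ = B₂ * (∏ i, ∑ Q : Pauli, ‖(Q.mat * M i).trace / 2‖) + B₁ := by
        rw [Finset.prod_univ_sum, Fintype.piFinset_univ]
    _ = B₂ * (∏ i ∈ Finset.univ.filter (fun i => S i ≠ Pauli.I),
          (∑ P ∈ ({Pauli.X, Pauli.Y, Pauli.Z} : Finset Pauli), ‖(P.mat * M i).trace‖ / 2)) + B₁ := by
        rw [Finset.prod_filter]
        congr 2
        exact Finset.prod_congr rfl fun i _ => hsite i
    _ = _ := add_comm _ _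

/-! ### The cube graph state -/

/-- An indicator vector with value `c` is `c` times the `{0,1}`-indicator. -/
theorem indicator_const_eq_smul {α : Type*} (P : α → Prop) [DecidablePred P] (c : ℂ) :
    (fun w => if P w then c else 0) = c • fun w => if P w then (1 : ℂ) else 0 := by
  funext w
  simp

/-- The word `Z^{supp S}` is not the identity when `S ≠ I`. -/
theorem zWord_ne_I {ι : Type*} {S : ι → Pauli} (hS : S ≠ fun _ => Pauli.I) :
    (fun i => if S i = Pauli.I then Pauli.I else Pauli.Z) ≠ fun _ => Pauli.I := by
  obtain ⟨k, hk⟩ := Function.ne_iff.1 hS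
  intro h
  have := congrFun h k
  simp only [hk, if_false] at this
  exact absurd this (by decide)

/-- **The light-regime estimate for the unnormalised cube graph vector** `g = Σ_x |x⟩|e((e⁻¹x)³)⟩`:
`|⟨g| ⊗ᵢ uᵢ σ_{Sᵢ} uᵢ† |g⟩| ≤ 2 √2ⁿ + 2 · ∏_{i ∈ supp S} Σ_{P ∈ {X,Y,Z}} |½ Tr(σ_P uᵢ σ_{Sᵢ} uᵢ†)|`
(`cubeGraphFlat_main` for the `Z`-word, `card_cube_graph_pairs_le_two` for the flipping words). -/
theorem lightFlat_unnormalised (n : ℕ) (K : Type) [Field K] [Fintype K]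
    (hK : Fintype.card K = 2 ^ n) (e : K ≃+ (Fin n → ZMod 2))
    (u : Fin (n + n) → Matrix Bool Bool ℂ) (hu : ∀ i, u i ∈ Matrix.unitaryGroup Bool ℂ)
    (S : Fin (n + n) → Pauli) (hS : S ≠ fun _ => Pauli.I) :
    ‖star (fun w : QReg (n + n) => if (fun j : Fin n => w (Fin.natAdd n j)) = (fun j : Fin n => decide (e ((e.symm (fun i : Fin n => if w (Fin.castAdd n i) then 1 else 0)) ^ 3) j = 1)) then (1 : ℂ) else 0) ⬝ᵥ (tensorAll (fun i => u i * (S i).mat * star (u i))).mulVec (fun w : QReg (n + n) => if (fun j : Fin n => w (Fin.natAdd n j)) = (fun j : Fin n => decide (e ((e.symm (fun i : Fin n => if w (Fin.castAdd n i) then 1 else 0)) ^ 3) j = 1)) then (1 : ℂ) else 0)‖ ≤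
      2 * Real.sqrt 2 ^ n + 2 * ∏ i ∈ Finset.univ.filter (fun i => S i ≠ Pauli.I),
        (∑ P ∈ ({Pauli.X, Pauli.Y, Pauli.Z} : Finset Pauli),
          ‖(P.mat * (u i * (S i).mat * star (u i))).trace‖ / 2) := by
  classical
  have hMu : ∀ i, u i * (S i).mat * star (u i) ∈ Matrix.unitaryGroup Bool ℂ := fun i =>
    Submonoid.mul_mem _ (Submonoid.mul_mem _ (hu i) (pauliMat_mem_unitaryGroup _))
      (Unitary.star_mem (hu i))
  have hI : ∀ i, S i = Pauli.I → u i * (S i).mat * star (u i) = 1 := by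
    intro i hi
    rw [hi, show Pauli.I.mat = (1 : Matrix Bool Bool ℂ) from rfl, Matrix.mul_one]
    exact Matrix.mem_unitaryGroup_iff.1 (hu i)
  have htr : ∀ i, S i ≠ Pauli.I → (u i * (S i).mat * star (u i)).trace = 0 := by
    intro i hi
    rw [Matrix.trace_mul_cycle, Unitary.star_mul_self_of_mem (hu i), Matrix.one_mul, trace_pauliMat,
      if_neg hi]
  refine norm_dot_tensorAll_mulVec_le (fun i => u i * (S i).mat * star (u i)) hMu S hI htr _
    (by norm_num : (0 : ℝ) ≤ 2) ?_ ?_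
  · exact cubeGraphFlat_main n K hK e _ (zWord_ne_I hS)
  · intro R hfl
    refine le_trans (norm_indicator_dot_le_card R _) ?_
    refine le_trans (Nat.cast_le.2 (card_cube_graph_pairs_le_two hK e R hfl)) ?_
    norm_num

/-- The rate: `4 / √2ⁿ ≤ 2^{-n/4}` for `n ≥ 8`. -/
theorem four_div_sqrt_two_pow_le {n : ℕ} (hn : 8 ≤ n) :
    4 * (Real.sqrt 2 ^ n)⁻¹ ≤ (2 : ℝ) ^ (-(1 / 4 * (n : ℝ))) := by
  have hn' : (8 : ℝ) ≤ n := by exact_mod_cast hn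
  have h2 : Real.sqrt 2 ^ n = (2 : ℝ) ^ ((1 / 2 : ℝ) * n) := by
    rw [Real.sqrt_eq_rpow, Real.rpow_mul_natCast (by norm_num : (0 : ℝ) ≤ 2)]
  have h4 : (4 : ℝ) * (Real.sqrt 2 ^ n)⁻¹ = (2 : ℝ) ^ (2 + -((1 / 2 : ℝ) * n)) := by
    rw [Real.rpow_add (by norm_num : (0 : ℝ) < 2), Real.rpow_neg (by norm_num : (0 : ℝ) ≤ 2), h2]
    norm_num
  rw [h4]
  exact Real.rpow_le_rpow_of_exponent_le (by norm_num) (by linarith)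

/-- **Stub `stub_lightFlat`** of line `Sketch` (crux `DeqThesis`, stmt-QuantumAdvantage-0242):
`CubeLocallyFlat` in the LIGHT regime `∏_{i : Sᵢ ≠ I} Σ_{P ∈ {X,Y,Z}} |½ Tr(σ_P uᵢ σ_{Sᵢ} uᵢ†)| ≤ √2ⁿ`,
with `δ = 1/4` and `n₀ = 8`: the normalised cube graph state `ĝ = (√2ⁿ)⁻¹ Σ_x |x⟩|e((e⁻¹x)³)⟩` has
`|⟨ĝ| ⊗ᵢ uᵢ σ_{Sᵢ} uᵢ† |ĝ⟩| ≤ (2 √2ⁿ + 2 √2ⁿ) / 2ⁿ = 4 / √2ⁿ ≤ 2^{-n/4}` — one Walsh word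
(`cubeGraphFlat_main`) plus the differential words (`card_cube_graph_pairs_le_two`) weighted by the Bloch
`ℓ¹`-mass (`lightFlat_unnormalised`). -/
theorem stub_lightFlat :
    ∃ δ : ℝ, 0 < δ ∧ ∃ n₀ : ℕ, ∀ n ≥ n₀, ∀ (K : Type) [Field K] [Fintype K], Fintype.card K = 2 ^ n →
      ∀ e : K ≃+ (Fin n → ZMod 2),
      ∀ u : Fin (n + n) → Matrix Bool Bool ℂ, (∀ i, u i ∈ Matrix.unitaryGroup Bool ℂ) →
        ∀ S : Fin (n + n) → Pauli, S ≠ (fun _ => Pauli.I) →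
          (∏ i ∈ Finset.univ.filter (fun i => S i ≠ Pauli.I),
              (∑ P ∈ ({Pauli.X, Pauli.Y, Pauli.Z} : Finset Pauli),
                ‖(P.mat * (u i * (S i).mat * star (u i))).trace‖ / 2) ≤ Real.sqrt 2 ^ n) →
          ‖star (fun w : QReg (n + n) =>
                if (fun j : Fin n => w (Fin.natAdd n j)) =
                    (fun j : Fin n => decide (e ((e.symm (fun i : Fin n => if w (Fin.castAdd n i) then 1 else 0)) ^ 3) j = 1))
                then ((Real.sqrt 2 ^ n)⁻¹ : ℂ) else 0) ⬝ᵥ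
              (tensorAll (fun i => u i * (S i).mat * star (u i))).mulVec
                (fun w : QReg (n + n) =>
                  if (fun j : Fin n => w (Fin.natAdd n j)) =
                      (fun j : Fin n => decide (e ((e.symm (fun i : Fin n => if w (Fin.castAdd n i) then 1 else 0)) ^ 3) j = 1))
                  then ((Real.sqrt 2 ^ n)⁻¹ : ℂ) else 0)‖
            ≤ (2 : ℝ) ^ (-(δ * (n : ℝ))) := by
  refine ⟨1 / 4, by norm_num, 8, ?_⟩
  intro n hn K _ _ hK e u hu S hS hlight
  rw [indicator_const_eq_smul, star_smul, Matrix.mulVec_smul, smul_dotProduct, dotProduct_smul,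
    smul_eq_mul, smul_eq_mul, norm_mul, norm_mul, norm_star]
  have hcore := lightFlat_unnormalised n K hK e u hu S hS
  have hc : ‖((Real.sqrt 2 : ℂ) ^ n)⁻¹‖ = (Real.sqrt 2 ^ n)⁻¹ := by
    rw [norm_inv, norm_pow, Complex.norm_real, Real.norm_of_nonneg (Real.sqrt_nonneg _)]
  rw [hc]
  have hs : 0 < Real.sqrt 2 ^ n := by positivity
  refine le_trans ?_ (four_div_sqrt_two_pow_le hn)
  calc (Real.sqrt 2 ^ n)⁻¹ * ((Real.sqrt 2 ^ n)⁻¹ * _)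
      ≤ (Real.sqrt 2 ^ n)⁻¹ * ((Real.sqrt 2 ^ n)⁻¹ * (4 * Real.sqrt 2 ^ n)) := by
        gcongr
        linarith [hcore, hlight]
    _ = 4 * (Real.sqrt 2 ^ n)⁻¹ := by
        field_simp

end Summit.QuantumAdvantage.QuantumAdvantage.Theorems.SymplecticPurity
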